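import Mathlib
import HarnessLib
import Literature.Analysis.PDE.LaplacianInequalities

/-!
# Isoparametric functions in the plane: the Hessian and the unit normal are determined by the level value
# (pointwise structure behind the Somigliana–Levi-Civita–Segre theorem) [cite: CecilRyan1985, Ch. 3 §0 and §5] [cite: Segre1938Isoparametric]

Analysis/Calculus support file (everything proved, no named facts).  A function `W` on an open subset of the
Euclidean plane is ISOPARAMETRIC when both `|∇W|²` and `ΔW` are functions of `W`: `|∇W|² = a ∘ W`, `ΔW = b ∘ W`
[cite: CecilRyan1985, Ch. 3 §0 (the two Beltrami parameters are functions of `W`)] (Segre [cite: Segre1938Isoparametric], following Somigliana 1918 and Levi-Civita 1937, proved that the level curves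
of such a function are parallel straight lines or concentric circles; in `ℝⁿ`: parallel hyperplanes, concentric
spheres, coaxial spherical cylinders).  This file proves the POINTWISE first half of the planar statement, in
coordinates `e₀, e₁` of `EuclideanSpace ℝ (Fin 2)` (write `p = ∂₀W`, `q = ∂₁W`, `r = ∂₀∂₀W`, `s = ∂₁∂₀W = ∂₀∂₁W`,
`t = ∂₁∂₁W`, `λ₁ = a′(W)/2`, `λ₂ = b(W) − a′(W)/2`):

* `hessian_entries_of_eigen` — pure algebra: a symmetric `2 × 2` matrix `[[r,s],[s,t]]` with eigenvector `(p,q) ≠ 0`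
  for the eigenvalue `λ₁` and trace `λ₁ + λ₂` is `λ₁ n⊗n + λ₂ τ⊗τ` (`n = (p,q)/|(p,q)|`, `τ = (−q,p)/|(p,q)|`):
  `(p²+q²) r = λ₁p² + λ₂q²`, `(p²+q²) s = (λ₁−λ₂)pq`, `(p²+q²) t = λ₁q² + λ₂p²`.
* `gradient_is_hessian_eigenvector` — differentiating `p² + q² = a(W)` along `e₀, e₁`:
  `r p + s q = λ₁ p`, `s p + t q = λ₁ q` (the gradient is an eigenvector of the Hessian, eigenvalue `a′(W)/2`).
* `hessian_of_isoparametric` — **the Hessian of an isoparametric function**: at a point where `W` is `C²`, `a` is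
  differentiable at `W(x)`, `|∇W|² = a ∘ W` near `x`, `ΔW(x) = b(W(x))` and `∇W(x) ≠ 0`:
  `a·∂ᵢ∂ⱼW = λ₁ ∂ᵢW ∂ⱼW + λ₂ (a δᵢⱼ − ∂ᵢW ∂ⱼW)` (all three entries).
* `fderiv_centreMap_of_isoparametric` — **the curvature-centre map** `m = ∇W / λ₂` (square-root free form of
  `n/k`, `n = ∇W/√a` the unit normal, `k = λ₂/√a` the curvature of the level curves): with the Hessian above,
  `Dm = τ⊗τ + μ n⊗n − n ⊗ (∇λ₂/λ₂ − its normal part)` — the `τ⊗τ`-coefficient is exactly `1`.  The global half of the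
  Segre theorem (the `n⊗n`-coefficient vanishes too, so `c = x − m` is locally constant and the level curves are
  circles about `c`, or `λ₂ ≡ 0` and they are parallel lines) needs one more derivative and is left to a sequel.

Consumer: the structural route to the poloidal Type-I Liouville crux of `Summits/NavierStokesRegularity`
(crux `PoloidalWindowRigidity`, item `LrcModEntire`): the vortex-line foliation of a poloidal Navier–Stokes germ is
found to be isoparametric at the collapse order of the jet scheme (cell ns-regularity-ideate, K2 lead notes 2026-08-27),
and the Segre dichotomy turns that into a horizontal Killing symmetry of the vorticity.

WHAT THIS IS NOT: not the Segre classification itself (no conclusion about circles/lines yet), and nothing in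
dimension `≥ 3`.
-/

noncomputable section

namespace Literature.Analysis.Calculus.PlaneIsoparametric

open Set Function Filter InnerProductSpace
open scoped Laplacian ContDiff
open _root_.Topology

/-! ### §1. Linear algebra of a symmetric `2×2` matrix with a prescribed eigenvector and trace -/

/-- A symmetric `2×2` matrix `[[r,s],[s,t]]` with `(p,q) ≠ 0` as eigenvector for `λ₁` and trace `λ₁ + λ₂` equals
`λ₁ n⊗n + λ₂ τ⊗τ` with `n ∥ (p,q)`, `τ ∥ (−q,p)`: its three entries, cleared of the denominator `p² + q²`.
[folklore] -/
private theorem hessian_entries_of_eigen {p q r s t l₁ l₂ : ℝ}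
    (h₁ : r * p + s * q = l₁ * p) (h₂ : s * p + t * q = l₁ * q) (h₃ : r + t = l₁ + l₂) :
    (p ^ 2 + q ^ 2) * r = l₁ * p ^ 2 + l₂ * q ^ 2 ∧
      (p ^ 2 + q ^ 2) * s = (l₁ - l₂) * p * q ∧
        (p ^ 2 + q ^ 2) * t = l₁ * q ^ 2 + l₂ * p ^ 2 := by
  refine ⟨?_, ?_, ?_⟩
  · linear_combination p * h₁ - q * h₂ + q ^ 2 * h₃
  · linear_combination q * h₁ + p * h₂ - p * q * h₃
  · linear_combination q * h₂ - p * h₁ + p ^ 2 * h₃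

/-! ### §2. The Hessian of an isoparametric function -/

section Hessian

variable {W : EuclideanSpace ℝ (Fin 2) → ℝ} {a b : ℝ → ℝ} {x : EuclideanSpace ℝ (Fin 2)}

/-- **The gradient of a transnormal function is an eigenvector of its Hessian** (eigenvalue `a′(W)/2`):
differentiating `(∂₀W)² + (∂₁W)² = a(W)` along `eⱼ` gives `2(∂₀W ∂ⱼ∂₀W + ∂₁W ∂ⱼ∂₁W) = a′(W) ∂ⱼW` — the first
step of «an isoparametric family is a family of PARALLEL hypersurfaces» [cite: CecilRyan1985, Ch. 3 §5]. -/
theorem gradient_is_hessian_eigenvector (hW : ContDiffAt ℝ 2 W x) {a' : ℝ} (ha : HasDerivAt a a' (W x))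
    (h₁ : ∀ᶠ y in 𝓝 x, (fderiv ℝ W y (EuclideanSpace.single 0 1)) ^ 2 +
      (fderiv ℝ W y (EuclideanSpace.single 1 1)) ^ 2 = a (W y)) (j : Fin 2) :
    fderiv ℝ W x (EuclideanSpace.single 0 1) *
        fderiv ℝ (fun y => fderiv ℝ W y (EuclideanSpace.single 0 1)) x (EuclideanSpace.single j 1) +
      fderiv ℝ W x (EuclideanSpace.single 1 1) *
        fderiv ℝ (fun y => fderiv ℝ W y (EuclideanSpace.single 1 1)) x (EuclideanSpace.single j 1) =
      a' / 2 * fderiv ℝ W x (EuclideanSpace.single j 1) := by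
  -- the partials `y ↦ ∂ᵢW(y)` are differentiable at `x`
  have hd : ∀ i : Fin 2, DifferentiableAt ℝ (fun y => fderiv ℝ W y (EuclideanSpace.single i 1)) x := by
    intro i
    have h := (hW.fderiv_right (m := 1) (by norm_num)).differentiableAt (by norm_num)
    exact (ContinuousLinearMap.apply ℝ ℝ (EuclideanSpace.single i (1 : ℝ))).differentiableAt.comp x h
  have hWd : DifferentiableAt ℝ W x := hW.differentiableAt (by norm_num)
  -- differentiate both sides of `h₁` at `x` along `eⱼ` (product form)
  set f0 : EuclideanSpace ℝ (Fin 2) → ℝ := fun y => fderiv ℝ W y (EuclideanSpace.single 0 1) with hf0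
  set f1 : EuclideanSpace ℝ (Fin 2) → ℝ := fun y => fderiv ℝ W y (EuclideanSpace.single 1 1) with hf1
  have hF0 : HasFDerivAt f0 (fderiv ℝ f0 x) x := (hd 0).hasFDerivAt
  have hF1 : HasFDerivAt f1 (fderiv ℝ f1 x) x := (hd 1).hasFDerivAt
  have hLHS : HasFDerivAt (fun y => f0 y * f0 y + f1 y * f1 y)
      (f0 x • fderiv ℝ f0 x + f0 x • fderiv ℝ f0 x + (f1 x • fderiv ℝ f1 x + f1 x • fderiv ℝ f1 x)) x :=
    (hF0.mul hF0).add (hF1.mul hF1)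
  have hRHS : HasFDerivAt (fun y => a (W y)) (a' • fderiv ℝ W x) x := ha.comp_hasFDerivAt x hWd.hasFDerivAt
  have heq : (fun y => f0 y * f0 y + f1 y * f1 y) =ᶠ[𝓝 x] fun y => a (W y) := by
    filter_upwards [h₁] with y hy
    simp only [hf0, hf1] at hy ⊢
    nlinarith [hy]
  have hD : f0 x • fderiv ℝ f0 x + f0 x • fderiv ℝ f0 x + (f1 x • fderiv ℝ f1 x + f1 x • fderiv ℝ f1 x) =
      a' • fderiv ℝ W x := by
    rw [← hLHS.fderiv, ← hRHS.fderiv]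
    exact heq.fderiv_eq
  have hpt := congrArg (fun L : EuclideanSpace ℝ (Fin 2) →L[ℝ] ℝ => L (EuclideanSpace.single j 1)) hD
  simp only [_root_.add_apply, FunLike.coe_smul, Pi.smul_apply, smul_eq_mul, hf0, hf1] at hpt
  linarith

/-- **THE HESSIAN OF AN ISOPARAMETRIC FUNCTION** (planar, pointwise).  Let `W` be `C²` at `x`, `a` differentiable at
`W(x)` with derivative `a'`, `(∂₀W)² + (∂₁W)² = a(W)` near `x` and `∂₀∂₀W(x) + ∂₁∂₁W(x) = β` (the Laplacian value,
`β = b(W(x))` for an isoparametric `W`).  With `p = ∂₀W(x)`, `q = ∂₁W(x)`, `λ₁ = a′/2`, `λ₂ = β − a′/2`: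
`(p²+q²) ∂₀∂₀W = λ₁p² + λ₂q²`, `(p²+q²) ∂₁∂₀W = (λ₁−λ₂)pq`, `(p²+q²) ∂₁∂₁W = λ₁q² + λ₂p²`
— the Hessian is `λ₁ n⊗n + λ₂ τ⊗τ` in the frame of the level curve: the level curves form a parallel family with
principal curvature `λ₂/√a` constant along each curve [cite: CecilRyan1985, Ch. 3 §5] [cite: Segre1938Isoparametric]. -/
theorem hessian_of_isoparametric (hW : ContDiffAt ℝ 2 W x) {a' β : ℝ} (ha : HasDerivAt a a' (W x))
    (h₁ : ∀ᶠ y in 𝓝 x, (fderiv ℝ W y (EuclideanSpace.single 0 1)) ^ 2 +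
      (fderiv ℝ W y (EuclideanSpace.single 1 1)) ^ 2 = a (W y))
    (h₂ : fderiv ℝ (fun y => fderiv ℝ W y (EuclideanSpace.single 0 1)) x (EuclideanSpace.single 0 1) +
      fderiv ℝ (fun y => fderiv ℝ W y (EuclideanSpace.single 1 1)) x (EuclideanSpace.single 1 1) = β) :
    (fderiv ℝ W x (EuclideanSpace.single 0 1) ^ 2 + fderiv ℝ W x (EuclideanSpace.single 1 1) ^ 2) *
        fderiv ℝ (fun y => fderiv ℝ W y (EuclideanSpace.single 0 1)) x (EuclideanSpace.single 0 1) =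
      a' / 2 * fderiv ℝ W x (EuclideanSpace.single 0 1) ^ 2 +
        (β - a' / 2) * fderiv ℝ W x (EuclideanSpace.single 1 1) ^ 2 ∧
    (fderiv ℝ W x (EuclideanSpace.single 0 1) ^ 2 + fderiv ℝ W x (EuclideanSpace.single 1 1) ^ 2) *
        fderiv ℝ (fun y => fderiv ℝ W y (EuclideanSpace.single 0 1)) x (EuclideanSpace.single 1 1) =
      (a' / 2 - (β - a' / 2)) * fderiv ℝ W x (EuclideanSpace.single 0 1) * fderiv ℝ W x (EuclideanSpace.single 1 1) ∧
    (fderiv ℝ W x (EuclideanSpace.single 0 1) ^ 2 + fderiv ℝ W x (EuclideanSpace.single 1 1) ^ 2) *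
        fderiv ℝ (fun y => fderiv ℝ W y (EuclideanSpace.single 1 1)) x (EuclideanSpace.single 1 1) =
      a' / 2 * fderiv ℝ W x (EuclideanSpace.single 1 1) ^ 2 +
        (β - a' / 2) * fderiv ℝ W x (EuclideanSpace.single 0 1) ^ 2 := by
  have e0 := gradient_is_hessian_eigenvector hW ha h₁ 0
  have e1 := gradient_is_hessian_eigenvector hW ha h₁ 1
  -- symmetry of the mixed partials
  have hsym : fderiv ℝ (fun y => fderiv ℝ W y (EuclideanSpace.single 1 1)) x (EuclideanSpace.single 0 1) =
      fderiv ℝ (fun y => fderiv ℝ W y (EuclideanSpace.single 0 1)) x (EuclideanSpace.single 1 1) :=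
    Literature.Analysis.PDE.fderiv_fderiv_apply_comm hW _ _
  rw [hsym] at e0
  -- name the five numbers and apply §1
  set p := fderiv ℝ W x (EuclideanSpace.single 0 1)
  set q := fderiv ℝ W x (EuclideanSpace.single 1 1)
  set r := fderiv ℝ (fun y => fderiv ℝ W y (EuclideanSpace.single 0 1)) x (EuclideanSpace.single 0 1)
  set s := fderiv ℝ (fun y => fderiv ℝ W y (EuclideanSpace.single 0 1)) x (EuclideanSpace.single 1 1)
  set t := fderiv ℝ (fun y => fderiv ℝ W y (EuclideanSpace.single 1 1)) x (EuclideanSpace.single 1 1)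
  have h3 : r + t = a' / 2 + (β - a' / 2) := by linarith
  exact hessian_entries_of_eigen (l₁ := a' / 2) (l₂ := β - a' / 2) (by linarith) (by linarith) h3

end Hessian

/-! ### §3. The curvature-centre map `m = ∇W / λ₂(W)`: its derivative is `τ⊗τ + μ n⊗n` -/

section CentreMap

variable {W : EuclideanSpace ℝ (Fin 2) → ℝ} {a : ℝ → ℝ} {x : EuclideanSpace ℝ (Fin 2)}

/-- **DERIVATIVE OF THE CURVATURE-CENTRE MAP.**  In the situation of `hessian_of_isoparametric`, suppose moreover that
near `x` the Laplacian value is a differentiable function `ℓ` of the point with `ℓ(x) = β`, derivative `ℓ′ = DΛ(x)`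
(for an isoparametric `W`, `ℓ = b ∘ W`), and that `a′` is likewise replaced by a differentiable function `α` with
`α(x) = a′` — packaged as the single differentiable function `L(y) := λ₂(y) = ℓ(y) − α(y)/2` with `L(x) = β − a′/2 ≠ 0`.
Then the sqrt-free CENTRE MAP `mᵢ := ∂ᵢW / L` has, at `x`,
`(p²+q²) L(x)² ∂ⱼ mᵢ = L(x) [λ₁ ∂ᵢW∂ⱼW + L(x) ((p²+q²)δᵢⱼ − ∂ᵢW∂ⱼW)] − (p²+q²) ∂ᵢW · ∂ⱼL`,
i.e. `Dm = τ⊗τ + μ n⊗n − n ⊗ ∇L/L`: the `τ⊗τ`-coefficient is EXACTLY `1`.  (When `∂ⱼL = L′(W)∂ⱼW` is along the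
gradient, `Dm − Id` is a multiple of `n⊗n`; the Segre theorem is the statement that this multiple vanishes, so that
`c = x − m` is locally constant and the level curves are circles about `c`.)
[cite: CecilRyan1985, Ch. 3 §5] [cite: Segre1938Isoparametric] -/
theorem fderiv_centreMap_of_isoparametric (hW : ContDiffAt ℝ 2 W x) {a' β : ℝ} (ha : HasDerivAt a a' (W x))
    (h₁ : ∀ᶠ y in 𝓝 x, (fderiv ℝ W y (EuclideanSpace.single 0 1)) ^ 2 +
      (fderiv ℝ W y (EuclideanSpace.single 1 1)) ^ 2 = a (W y))
    (h₂ : fderiv ℝ (fun y => fderiv ℝ W y (EuclideanSpace.single 0 1)) x (EuclideanSpace.single 0 1) +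
      fderiv ℝ (fun y => fderiv ℝ W y (EuclideanSpace.single 1 1)) x (EuclideanSpace.single 1 1) = β)
    {L : EuclideanSpace ℝ (Fin 2) → ℝ} (hL : DifferentiableAt ℝ L x) (hLx : L x = β - a' / 2) (hLne : L x ≠ 0)
    (i j : Fin 2) :
    (fderiv ℝ W x (EuclideanSpace.single 0 1) ^ 2 + fderiv ℝ W x (EuclideanSpace.single 1 1) ^ 2) * L x ^ 2 *
        fderiv ℝ (fun y => fderiv ℝ W y (EuclideanSpace.single i 1) / L y) x (EuclideanSpace.single j 1) =
      L x * (a' / 2 * (fderiv ℝ W x (EuclideanSpace.single i 1) * fderiv ℝ W x (EuclideanSpace.single j 1)) +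
          L x * ((fderiv ℝ W x (EuclideanSpace.single 0 1) ^ 2 + fderiv ℝ W x (EuclideanSpace.single 1 1) ^ 2) *
              (if i = j then 1 else 0) -
            fderiv ℝ W x (EuclideanSpace.single i 1) * fderiv ℝ W x (EuclideanSpace.single j 1))) -
        (fderiv ℝ W x (EuclideanSpace.single 0 1) ^ 2 + fderiv ℝ W x (EuclideanSpace.single 1 1) ^ 2) *
          fderiv ℝ W x (EuclideanSpace.single i 1) * fderiv ℝ L x (EuclideanSpace.single j 1) := by
  have hd : ∀ i : Fin 2, DifferentiableAt ℝ (fun y => fderiv ℝ W y (EuclideanSpace.single i 1)) x := by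
    intro i
    have h := (hW.fderiv_right (m := 1) (by norm_num)).differentiableAt (by norm_num)
    exact (ContinuousLinearMap.apply ℝ ℝ (EuclideanSpace.single i (1 : ℝ))).differentiableAt.comp x h
  -- product rule for `∂ᵢW · L⁻¹`
  have hinv : HasFDerivAt (fun y => (L y)⁻¹) ((-(L x ^ 2)⁻¹) • fderiv ℝ L x) x := by
    have h := (hasDerivAt_inv hLne).comp_hasFDerivAt x hL.hasFDerivAt
    simpa [Function.comp_def] using h
  have hprod : HasFDerivAt (fun y => fderiv ℝ W y (EuclideanSpace.single i 1) * (L y)⁻¹)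
      (fderiv ℝ W x (EuclideanSpace.single i 1) • ((-(L x ^ 2)⁻¹) • fderiv ℝ L x) +
        (L x)⁻¹ • fderiv ℝ (fun y => fderiv ℝ W y (EuclideanSpace.single i 1)) x) x :=
    (hd i).hasFDerivAt.mul hinv
  have hfun : (fun y => fderiv ℝ W y (EuclideanSpace.single i 1) / L y) =
      fun y => fderiv ℝ W y (EuclideanSpace.single i 1) * (L y)⁻¹ := by
    funext y; rw [div_eq_mul_inv]
  rw [hfun, hprod.fderiv]
  simp only [_root_.add_apply, FunLike.coe_smul, Pi.smul_apply, smul_eq_mul]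
  -- clear the denominators: `A L² (P (−L⁻² M) + L⁻¹ Q) = A L Q − A P M`
  have hcl : ∀ P Q M : ℝ,
      (fderiv ℝ W x (EuclideanSpace.single 0 1) ^ 2 + fderiv ℝ W x (EuclideanSpace.single 1 1) ^ 2) * L x ^ 2 *
          (P * (-(L x ^ 2)⁻¹ * M) + (L x)⁻¹ * Q) =
        (fderiv ℝ W x (EuclideanSpace.single 0 1) ^ 2 + fderiv ℝ W x (EuclideanSpace.single 1 1) ^ 2) * L x * Q -
          (fderiv ℝ W x (EuclideanSpace.single 0 1) ^ 2 + fderiv ℝ W x (EuclideanSpace.single 1 1) ^ 2) * P * M := by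
    intro P Q M
    field_simp
    ring
  -- Hessian entries
  obtain ⟨hr, hs, ht⟩ := hessian_of_isoparametric hW ha h₁ h₂
  have hsym : fderiv ℝ (fun y => fderiv ℝ W y (EuclideanSpace.single 1 1)) x (EuclideanSpace.single 0 1) =
      fderiv ℝ (fun y => fderiv ℝ W y (EuclideanSpace.single 0 1)) x (EuclideanSpace.single 1 1) :=
    Literature.Analysis.PDE.fderiv_fderiv_apply_comm hW _ _
  fin_cases i <;> fin_cases j
  · simp only [Fin.zero_eta, Fin.isValue, ↓reduceIte, mul_one]
    rw [hcl]
    linear_combination (L x) * hr - (L x) * fderiv ℝ W x (EuclideanSpace.single 1 1) ^ 2 * hLx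
  · simp only [Fin.zero_eta, Fin.isValue, Fin.mk_one, zero_ne_one, ↓reduceIte, mul_zero]
    rw [hcl]
    linear_combination (L x) * hs +
      (L x) * fderiv ℝ W x (EuclideanSpace.single 0 1) * fderiv ℝ W x (EuclideanSpace.single 1 1) * hLx
  · simp only [Fin.mk_one, Fin.isValue, Fin.zero_eta, one_ne_zero, ↓reduceIte, mul_zero]
    rw [hcl, hsym]
    linear_combination (L x) * hs +
      (L x) * fderiv ℝ W x (EuclideanSpace.single 0 1) * fderiv ℝ W x (EuclideanSpace.single 1 1) * hLx
  · simp only [Fin.mk_one, Fin.isValue, ↓reduceIte, mul_one]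
    rw [hcl]
    linear_combination (L x) * ht - (L x) * fderiv ℝ W x (EuclideanSpace.single 0 1) ^ 2 * hLx

end CentreMap

end Literature.Analysis.Calculus.PlaneIsoparametric

end

/-! ### §4. The integrability identity `a λ₂′ = λ₂ (λ₁ − λ₂)` (Codazzi equation of the level-curve foliation) -/

namespace Literature.Analysis.Calculus.PlaneIsoparametric

open Set Function Filter InnerProductSpace
open scoped Laplacian ContDiff
open _root_.Topology

section Codazzi

variable {E : Type*} [NormedAddCommGroup E] [NormedSpace ℝ E]

/-- Abstract product-rule step: if `A·R = L₁·P² + L₂·Q²` near `x`, the derivatives along `v` satisfy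
`A′R + A R′ = L₁′P² + 2L₁PP′ + L₂′Q² + 2L₂QQ′`. [folklore] -/
private theorem deriv_identity_R {A R L₁ L₂ P Q : E → ℝ} {x : E} {A' R' L₁' L₂' P' Q' : E →L[ℝ] ℝ}
    (hA : HasFDerivAt A A' x) (hR : HasFDerivAt R R' x) (hL₁ : HasFDerivAt L₁ L₁' x) (hL₂ : HasFDerivAt L₂ L₂' x)
    (hP : HasFDerivAt P P' x) (hQ : HasFDerivAt Q Q' x)
    (h : ∀ᶠ y in 𝓝 x, A y * R y = L₁ y * P y ^ 2 + L₂ y * Q y ^ 2) (v : E) :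
    A' v * R x + A x * R' v =
      L₁' v * P x ^ 2 + L₁ x * (2 * P x * P' v) + (L₂' v * Q x ^ 2 + L₂ x * (2 * Q x * Q' v)) := by
  have hl : HasFDerivAt (fun y => A y * R y) (A x • R' + R x • A') x := hA.mul hR
  have hr : HasFDerivAt (fun y => L₁ y * (P y * P y) + L₂ y * (Q y * Q y))
      (L₁ x • (P x • P' + P x • P') + (P x * P x) • L₁' + (L₂ x • (Q x • Q' + Q x • Q') + (Q x * Q x) • L₂')) x :=
    (hL₁.mul (hP.mul hP)).add (hL₂.mul (hQ.mul hQ))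
  have heq : (fun y => A y * R y) =ᶠ[𝓝 x] fun y => L₁ y * (P y * P y) + L₂ y * (Q y * Q y) := by
    filter_upwards [h] with y hy
    rw [hy]; ring
  have hD := heq.fderiv_eq (𝕜 := ℝ)
  rw [hl.fderiv, hr.fderiv] at hD
  have := congrArg (fun T : E →L[ℝ] ℝ => T v) hD
  simp only [_root_.add_apply, FunLike.coe_smul, Pi.smul_apply, smul_eq_mul] at this
  linear_combination this

/-- Abstract product-rule step: if `A·S = (L₁ − L₂)·P·Q` near `x`, the derivatives along `v` satisfy
`A′S + A S′ = (L₁′ − L₂′)PQ + (L₁ − L₂)(P′Q + PQ′)`. [folklore] -/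
private theorem deriv_identity_S {A S L₁ L₂ P Q : E → ℝ} {x : E} {A' S' L₁' L₂' P' Q' : E →L[ℝ] ℝ}
    (hA : HasFDerivAt A A' x) (hS : HasFDerivAt S S' x) (hL₁ : HasFDerivAt L₁ L₁' x) (hL₂ : HasFDerivAt L₂ L₂' x)
    (hP : HasFDerivAt P P' x) (hQ : HasFDerivAt Q Q' x)
    (h : ∀ᶠ y in 𝓝 x, A y * S y = (L₁ y - L₂ y) * P y * Q y) (v : E) :
    A' v * S x + A x * S' v =
      (L₁' v - L₂' v) * P x * Q x + (L₁ x - L₂ x) * (P' v * Q x + P x * Q' v) := by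
  have hl : HasFDerivAt (fun y => A y * S y) (A x • S' + S x • A') x := hA.mul hS
  have hr : HasFDerivAt (fun y => (L₁ y - L₂ y) * P y * Q y)
      (((L₁ x - L₂ x) * P x) • Q' + Q x • ((L₁ x - L₂ x) • P' + P x • (L₁' - L₂'))) x :=
    ((hL₁.sub hL₂).mul hP).mul hQ
  have heq : (fun y => A y * S y) =ᶠ[𝓝 x] fun y => (L₁ y - L₂ y) * P y * Q y := h
  have hD := heq.fderiv_eq (𝕜 := ℝ)
  rw [hl.fderiv, hr.fderiv] at hD
  have := congrArg (fun T : E →L[ℝ] ℝ => T v) hD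
  simp only [_root_.add_apply, _root_.sub_apply, FunLike.coe_smul, Pi.smul_apply, smul_eq_mul] at this
  linear_combination this

end Codazzi

section Integrability

variable {W : EuclideanSpace ℝ (Fin 2) → ℝ} {a b : ℝ → ℝ} {U : Set (EuclideanSpace ℝ (Fin 2))}
  {x : EuclideanSpace ℝ (Fin 2)}

/-- **THE INTEGRABILITY IDENTITY OF A PLANAR ISOPARAMETRIC FUNCTION** (Codazzi equation of the level-curve
foliation).  Let `W` be `C³` on an open set `U`, `a` be `C²`, `b` be `C¹`, and suppose `(∂₀W)² + (∂₁W)² = a(W)` and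
`∂₀∂₀W + ∂₁∂₁W = b(W)` on `U`.  Then at every `x ∈ U` with `∇W(x) ≠ 0`, writing `λ₁ = a′/2`, `λ₂ = b − a′/2` (functions
of the level value) and `λ₂′ = b′ − a″/2`:
`a(W x) · λ₂′(W x) = λ₂(W x) · (λ₁(W x) − λ₂(W x))`.
Equivalently the curvature `k = λ₂/√a` of the level curves satisfies `∂ₙk = −k²` along the unit normal — the
Riccati law of a family of PARALLEL curves; it is what makes the centre `x − ∇W/λ₂(W)` locally constant
(circles) or `λ₂ ≡ 0` (lines) [cite: CecilRyan1985, Ch. 3 §5] [cite: Segre1938Isoparametric].  Proof: differentiate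
`a(W)·∂₀∂₀W = λ₁(∂₀W)² + λ₂(∂₁W)²` along `e₁` and `a(W)·∂₁∂₀W = (λ₁−λ₂)∂₀W∂₁W` along `e₀`, cancel the third derivative by
the symmetry `∂₁∂₀∂₀W = ∂₀∂₁∂₀W`, and reduce with the Hessian identities: `∂₁W · a · [a λ₂′ + λ₂(λ₂−λ₁)] = 0`; the
twin computation gives the factor `∂₀W`, and `(∂₀W)² + (∂₁W)² = a > 0` concludes. -/
theorem integrability_of_isoparametric (hU : IsOpen U) (hx : x ∈ U) (hW : ContDiffOn ℝ 3 W U)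
    (ha : ContDiff ℝ 2 a) (hb : ContDiff ℝ 1 b)
    (h₁ : ∀ y ∈ U, (fderiv ℝ W y (EuclideanSpace.single 0 1)) ^ 2 +
      (fderiv ℝ W y (EuclideanSpace.single 1 1)) ^ 2 = a (W y))
    (h₂ : ∀ y ∈ U, fderiv ℝ (fun z => fderiv ℝ W z (EuclideanSpace.single 0 1)) y (EuclideanSpace.single 0 1) +
      fderiv ℝ (fun z => fderiv ℝ W z (EuclideanSpace.single 1 1)) y (EuclideanSpace.single 1 1) = b (W y))
    (hpos : 0 < a (W x)) :
    a (W x) * (deriv b (W x) - deriv (deriv a) (W x) / 2) =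
      (b (W x) - deriv a (W x) / 2) * (deriv a (W x) / 2 - (b (W x) - deriv a (W x) / 2)) := by
  -- ## notation-free names for the coordinate functions
  have hUx : U ∈ 𝓝 x := hU.mem_nhds hx
  have hW3 : ContDiffAt ℝ 3 W x := hW.contDiffAt hUx
  have hW2 : ∀ y ∈ U, ContDiffAt ℝ 2 W y := fun y hy => (hW.contDiffAt (hU.mem_nhds hy)).of_le (by norm_num)
  -- first partials as functions, `C²` on `U`
  have hPc : ∀ i : Fin 2, ContDiffOn ℝ 2 (fun y => fderiv ℝ W y (EuclideanSpace.single i 1)) U := fun i =>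
    Literature.Analysis.PDE.contDiffOn_fderiv_apply_const hU (n := 2) (by exact_mod_cast hW) _
  have hP2 : ∀ i : Fin 2, ContDiffAt ℝ 2 (fun y => fderiv ℝ W y (EuclideanSpace.single i 1)) x :=
    fun i => (hPc i).contDiffAt hUx
  -- second partials as functions, `C¹` on `U`
  have hSc : ∀ i j : Fin 2, ContDiffOn ℝ 1
      (fun y => fderiv ℝ (fun z => fderiv ℝ W z (EuclideanSpace.single i 1)) y (EuclideanSpace.single j 1)) U :=
    fun i j => Literature.Analysis.PDE.contDiffOn_fderiv_apply_const hU (n := 1) (by exact_mod_cast hPc i) _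
  have hSd : ∀ i j : Fin 2, DifferentiableAt ℝ
      (fun y => fderiv ℝ (fun z => fderiv ℝ W z (EuclideanSpace.single i 1)) y (EuclideanSpace.single j 1)) x :=
    fun i j => ((hSc i j).contDiffAt hUx).differentiableAt one_ne_zero
  have hPd : ∀ i : Fin 2, DifferentiableAt ℝ (fun y => fderiv ℝ W y (EuclideanSpace.single i 1)) x :=
    fun i => (hP2 i).differentiableAt (by norm_num)
  have hWd : DifferentiableAt ℝ W x := hW3.differentiableAt (by norm_num)
  -- the level-value functions `A = a∘W`, `L₁ = a′∘W/2`, `L₂ = b∘W − a′∘W/2`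
  have ha1 : Differentiable ℝ a := ha.differentiable (by norm_num)
  have hda : ContDiff ℝ 1 (deriv a) := by
    have h := (contDiff_succ_iff_deriv (n := 1) (f := a)).1 (by simpa [one_add_one_eq_two] using ha)
    exact h.2.2
  have hda1 : Differentiable ℝ (deriv a) := hda.differentiable one_ne_zero
  have hb1 : Differentiable ℝ b := hb.differentiable one_ne_zero
  have hA : HasFDerivAt (fun y => a (W y)) (deriv a (W x) • fderiv ℝ W x) x :=
    (ha1 (W x)).hasDerivAt.comp_hasFDerivAt x hWd.hasFDerivAt
  have hL₁ : HasFDerivAt (fun y => deriv a (W y) / 2) ((1 / 2 : ℝ) • (deriv (deriv a) (W x) • fderiv ℝ W x)) x := by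
    have h : HasFDerivAt (fun y => deriv a (W y)) (deriv (deriv a) (W x) • fderiv ℝ W x) x :=
      (hda1 (W x)).hasDerivAt.comp_hasFDerivAt x hWd.hasFDerivAt
    have hfun : (fun y => deriv a (W y) / 2) = fun y => (1 / 2 : ℝ) * deriv a (W y) := by
      funext y; ring
    rw [hfun]
    exact h.const_mul (1 / 2 : ℝ)
  have hL₂ : HasFDerivAt (fun y => b (W y) - deriv a (W y) / 2)
      (deriv b (W x) • fderiv ℝ W x - (1 / 2 : ℝ) • (deriv (deriv a) (W x) • fderiv ℝ W x)) x :=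
    ((hb1 (W x)).hasDerivAt.comp_hasFDerivAt x hWd.hasFDerivAt).sub hL₁
  -- the Hessian identities on `U` (file §2), written with `a(W)` for `p² + q²`
  have hHess : ∀ y ∈ U,
      a (W y) * fderiv ℝ (fun z => fderiv ℝ W z (EuclideanSpace.single 0 1)) y (EuclideanSpace.single 0 1) =
        deriv a (W y) / 2 * fderiv ℝ W y (EuclideanSpace.single 0 1) ^ 2 +
          (b (W y) - deriv a (W y) / 2) * fderiv ℝ W y (EuclideanSpace.single 1 1) ^ 2 ∧
      a (W y) * fderiv ℝ (fun z => fderiv ℝ W z (EuclideanSpace.single 0 1)) y (EuclideanSpace.single 1 1) =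
        (deriv a (W y) / 2 - (b (W y) - deriv a (W y) / 2)) * fderiv ℝ W y (EuclideanSpace.single 0 1) *
          fderiv ℝ W y (EuclideanSpace.single 1 1) ∧
      a (W y) * fderiv ℝ (fun z => fderiv ℝ W z (EuclideanSpace.single 1 1)) y (EuclideanSpace.single 1 1) =
        deriv a (W y) / 2 * fderiv ℝ W y (EuclideanSpace.single 1 1) ^ 2 +
          (b (W y) - deriv a (W y) / 2) * fderiv ℝ W y (EuclideanSpace.single 0 1) ^ 2 := by
    intro y hy
    have hev : ∀ᶠ z in 𝓝 y, (fderiv ℝ W z (EuclideanSpace.single 0 1)) ^ 2 +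
        (fderiv ℝ W z (EuclideanSpace.single 1 1)) ^ 2 = a (W z) := by
      filter_upwards [hU.mem_nhds hy] with z hz using h₁ z hz
    obtain ⟨hr, hs, ht⟩ := hessian_of_isoparametric (hW2 y hy) (ha1 (W y)).hasDerivAt hev (h₂ y hy)
    rw [h₁ y hy] at hr hs ht
    exact ⟨hr, hs, ht⟩
  -- ## the two differentiated identities at `x`
  have hevR : ∀ᶠ y in 𝓝 x,
      a (W y) * fderiv ℝ (fun z => fderiv ℝ W z (EuclideanSpace.single 0 1)) y (EuclideanSpace.single 0 1) =
        deriv a (W y) / 2 * fderiv ℝ W y (EuclideanSpace.single 0 1) ^ 2 +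
          (b (W y) - deriv a (W y) / 2) * fderiv ℝ W y (EuclideanSpace.single 1 1) ^ 2 := by
    filter_upwards [hUx] with y hy using (hHess y hy).1
  have hevS : ∀ᶠ y in 𝓝 x,
      a (W y) * fderiv ℝ (fun z => fderiv ℝ W z (EuclideanSpace.single 0 1)) y (EuclideanSpace.single 1 1) =
        (deriv a (W y) / 2 - (b (W y) - deriv a (W y) / 2)) * fderiv ℝ W y (EuclideanSpace.single 0 1) *
          fderiv ℝ W y (EuclideanSpace.single 1 1) := by
    filter_upwards [hUx] with y hy using (hHess y hy).2.1
  have hevT : ∀ᶠ y in 𝓝 x,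
      a (W y) * fderiv ℝ (fun z => fderiv ℝ W z (EuclideanSpace.single 1 1)) y (EuclideanSpace.single 1 1) =
        deriv a (W y) / 2 * fderiv ℝ W y (EuclideanSpace.single 1 1) ^ 2 +
          (b (W y) - deriv a (W y) / 2) * fderiv ℝ W y (EuclideanSpace.single 0 1) ^ 2 := by
    filter_upwards [hUx] with y hy using (hHess y hy).2.2
  have hevS' : ∀ᶠ y in 𝓝 x,
      a (W y) * fderiv ℝ (fun z => fderiv ℝ W z (EuclideanSpace.single 0 1)) y (EuclideanSpace.single 1 1) =
        (deriv a (W y) / 2 - (b (W y) - deriv a (W y) / 2)) * fderiv ℝ W y (EuclideanSpace.single 1 1) *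
          fderiv ℝ W y (EuclideanSpace.single 0 1) := by
    filter_upwards [hevS] with y hy
    rw [hy]; ring
  -- E_R: derivative of the `r`-identity along `e₁`; E_S: of the `s`-identity along `e₀`
  have ER := deriv_identity_R hA (hSd 0 0).hasFDerivAt hL₁ hL₂ (hPd 0).hasFDerivAt (hPd 1).hasFDerivAt hevR
    (EuclideanSpace.single 1 1)
  have ES := deriv_identity_S hA (hSd 0 1).hasFDerivAt hL₁ hL₂ (hPd 0).hasFDerivAt (hPd 1).hasFDerivAt hevS
    (EuclideanSpace.single 0 1)
  -- twin: `t`-identity along `e₀`, `s`-identity along `e₁` (roles of the coordinates exchanged)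
  have ET := deriv_identity_R hA (hSd 1 1).hasFDerivAt hL₁ hL₂ (hPd 1).hasFDerivAt (hPd 0).hasFDerivAt hevT
    (EuclideanSpace.single 0 1)
  have ES' := deriv_identity_S hA (hSd 0 1).hasFDerivAt hL₁ hL₂ (hPd 1).hasFDerivAt (hPd 0).hasFDerivAt hevS'
    (EuclideanSpace.single 1 1)
  simp only [FunLike.coe_smul, Pi.smul_apply, smul_eq_mul, _root_.sub_apply] at ER ES ET ES'
  -- ## third-derivative symmetries: ∂₁(∂₀∂₀W) = ∂₀(∂₁∂₀W) and ∂₀(∂₁∂₁W) = ∂₁(∂₁∂₀W)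
  have hsym3a : fderiv ℝ (fun y => fderiv ℝ (fun z => fderiv ℝ W z (EuclideanSpace.single 0 1)) y
        (EuclideanSpace.single 0 1)) x (EuclideanSpace.single 1 1) =
      fderiv ℝ (fun y => fderiv ℝ (fun z => fderiv ℝ W z (EuclideanSpace.single 0 1)) y
        (EuclideanSpace.single 1 1)) x (EuclideanSpace.single 0 1) :=
    Literature.Analysis.PDE.fderiv_fderiv_apply_comm (hP2 0) _ _
  have hsym3b : fderiv ℝ (fun y => fderiv ℝ (fun z => fderiv ℝ W z (EuclideanSpace.single 1 1)) y
        (EuclideanSpace.single 1 1)) x (EuclideanSpace.single 0 1) =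
      fderiv ℝ (fun y => fderiv ℝ (fun z => fderiv ℝ W z (EuclideanSpace.single 0 1)) y
        (EuclideanSpace.single 1 1)) x (EuclideanSpace.single 1 1) := by
    -- ∂₀∂₁(∂₁W) = ∂₁∂₀(∂₁W) = ∂₁[∂₀∂₁W] and ∂₀∂₁W = ∂₁∂₀W near x
    rw [Literature.Analysis.PDE.fderiv_fderiv_apply_comm (hP2 1) _ _]
    have hev : (fun y => fderiv ℝ (fun z => fderiv ℝ W z (EuclideanSpace.single 1 1)) y (EuclideanSpace.single 0 1))
        =ᶠ[𝓝 x] fun y => fderiv ℝ (fun z => fderiv ℝ W z (EuclideanSpace.single 0 1)) y (EuclideanSpace.single 1 1) := by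
      filter_upwards [hUx] with y hy using Literature.Analysis.PDE.fderiv_fderiv_apply_comm (hW2 y hy) _ _
    rw [hev.fderiv_eq]
  -- second-derivative symmetry at x: ∂₀(∂₁W) = ∂₁(∂₀W)
  have hsym2 : fderiv ℝ (fun z => fderiv ℝ W z (EuclideanSpace.single 1 1)) x (EuclideanSpace.single 0 1) =
      fderiv ℝ (fun z => fderiv ℝ W z (EuclideanSpace.single 0 1)) x (EuclideanSpace.single 1 1) :=
    Literature.Analysis.PDE.fderiv_fderiv_apply_comm (hW2 x hx) _ _
  -- ## the Hessian identities at `x` and the final algebra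
  obtain ⟨hr, hs, ht⟩ := hHess x hx
  have hAx : fderiv ℝ W x (EuclideanSpace.single 0 1) ^ 2 + fderiv ℝ W x (EuclideanSpace.single 1 1) ^ 2 = a (W x) :=
    h₁ x hx
  rw [hsym3a] at ER
  rw [hsym3b] at ET
  rw [hsym2] at ES ET
  -- abbreviate the numbers
  set p := fderiv ℝ W x (EuclideanSpace.single 0 1) with hp
  set q := fderiv ℝ W x (EuclideanSpace.single 1 1) with hq
  set r := fderiv ℝ (fun z => fderiv ℝ W z (EuclideanSpace.single 0 1)) x (EuclideanSpace.single 0 1) with hr'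
  set s := fderiv ℝ (fun z => fderiv ℝ W z (EuclideanSpace.single 0 1)) x (EuclideanSpace.single 1 1) with hs'
  set t := fderiv ℝ (fun z => fderiv ℝ W z (EuclideanSpace.single 1 1)) x (EuclideanSpace.single 1 1) with ht'
  set X₃ := fderiv ℝ (fun y => fderiv ℝ (fun z => fderiv ℝ W z (EuclideanSpace.single 0 1)) y
      (EuclideanSpace.single 1 1)) x (EuclideanSpace.single 0 1) with hX₃
  set Y₃ := fderiv ℝ (fun y => fderiv ℝ (fun z => fderiv ℝ W z (EuclideanSpace.single 0 1)) y
      (EuclideanSpace.single 1 1)) x (EuclideanSpace.single 1 1) with hY₃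
  set A := a (W x) with hA'
  set α := deriv a (W x) with hα
  set α' := deriv (deriv a) (W x) with hα'
  set B := b (W x) with hB
  set β' := deriv b (W x) with hβ'
  have hApos : A ≠ 0 := hpos.ne'
  -- E1 (from ∂₁ of the r-identity minus ∂₀ of the s-identity; the third derivative X₃ cancels)
  have E1 : q * (β' - α' / 2) * (p ^ 2 + q ^ 2) + (α + B) * p * s + (2 * B - α) * q * t - (2 * α - B) * q * r = 0 := by
    linear_combination ES - ER
  -- E2 (twin: ∂₀ of the t-identity minus ∂₁ of the s-identity; Y₃ cancels)
  have E2 : p * (β' - α' / 2) * (p ^ 2 + q ^ 2) + (α + B) * q * s + (2 * B - α) * p * r - (2 * α - B) * p * t = 0 := by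
    linear_combination ES' - ET
  -- multiply by A and reduce with the Hessian identities
  have AE1 : q * A * ((β' - α' / 2) * A + (B - α / 2) * ((B - α / 2) - α / 2)) = 0 := by
    linear_combination A * E1 - (α + B) * p * hs - (2 * B - α) * q * ht + (2 * α - B) * q * hr -
      q * ((β' - α' / 2) * A + (B - α / 2) * ((B - α / 2) - α / 2)) * hAx
  have AE2 : p * A * ((β' - α' / 2) * A + (B - α / 2) * ((B - α / 2) - α / 2)) = 0 := by
    linear_combination A * E2 - (α + B) * q * hs - (2 * B - α) * p * hr + (2 * α - B) * p * ht -
      p * ((β' - α' / 2) * A + (B - α / 2) * ((B - α / 2) - α / 2)) * hAx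
  have key : A * A * ((β' - α' / 2) * A + (B - α / 2) * ((B - α / 2) - α / 2)) = 0 := by
    linear_combination p * AE2 + q * AE1 -
      A * ((β' - α' / 2) * A + (B - α / 2) * ((B - α / 2) - α / 2)) * hAx
  have hA2 : A * A ≠ 0 := mul_ne_zero hApos hApos
  have h0 := (mul_eq_zero.1 key).resolve_left hA2
  linear_combination h0

end Integrability

end Literature.Analysis.Calculus.PlaneIsoparametric
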